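import Summits.QuantumFields.YangMills.Theorems.BalabanUVNodesPortS1BoxEditions
import Summits.QuantumFields.YangMills.Theorems.BalabanUVNodesPortS1HalvesJacGlue
import Summits.QuantumFields.YangMills.Theorems.BalabanUVNodesPortS1LZdetGlue
import Summits.QuantumFields.YangMills.Theorems.BalabanUVNodesPortRecordRepresentationS1StubLZdetTwin

/-!
# BalabanUVNodes — port (S1), the FE half AS PRINT's INDUCTION ON THE SCALE: the inductive-step letter `FEStepBox` ([I] Thm 3 at scale `k+1` from (1.7)+(1.18)
  at scales `≤ k`, p.268 L27–31 ∕ p.269 L30–33) and the kernel theorem «LZ half at every level + FE step ⟹ `PortRecordFEHalfBox`» by strong induction on `k`;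
  hence `stub_FE` of ⟨stmt-QuantumFields-27930⟩ v3.5 BY NAME from the δ-Jacobian sub-half (a theorem), `stub_P0C`, `stub_G3C` and `FEStepBox` (porter hand `hand-27930-FE-1` g0, cell `ym-nodeO-ideate`)

`--supports stmt-QuantumFields-27930` (helper; NO `--workitem`); count-neutral.  [I] = [Balaban1987RG1]; [II] = [Balaban1988RG2Cluster].

WHY.  The registered stub `stub_FE : ∀ F, PortRecordFEHalfBox F` (✓`…PortS1BoxEditions` :138) asks, with constants `γ₀ ε₂₉ E₂ κ α₀ α₁` chosen BEFORE `k`, for the wrap-aware residue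
`ResidueAtW … E₂ κ (phiFE F Mc a₀ ε₂₉ k v)` of print's SECOND BRACKET of (2.12) at EVERY level `k` and box history `v`.  Print does not prove that in one stroke: [I] p.268 L27–31 «By the
inductive assumption, and by the properties of the expressions given by explicit formulas, all terms in this representation satisfy the required properties, except possibly the last term
(2.13)» and p.269 L30–33 «Thus the proof of Theorem 3 is reduced to proving the remaining properties of (2.13), i.e. to a construction of the representation (1.7) with terms having the
analytic extensions satisfying the bound (1.18)» — the fluctuation integral (2.13) at scale `k+1` carries the curly bracket `{𝐄_k(U_k(·)) − 𝐄_k(U_k(V^{(k)}))}` whose `𝐄_k` is, by (0.23),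
the sum over `j < k` of the merged terms `𝓝_{j+1}` — i.e. of the objects ⟨27930⟩ represents AT THE LOWER LEVELS.  So the honest registrable shape of the FE half is the INDUCTIVE STEP (porter
▶ PT-A-1 `EK-CHART-BRICKS-v1.md` §2, ◇ lens-1 g14 №609 (D2) prediction «k-induction schema»), and the k-uniformity of the constants becomes a displayed obligation of the step exactly as in
print ((1.18) «κ ≥ κ₀», `γ ≤ γ₀(E₀)`).  THIS FILE types that step and PROVES the bookkeeping around it, so that the plan owner can re-point `stub_FE` on BYTES:
* §1 `LZResidueAt F Mc a₀ ε₂₉ α₀ α₁ E₁ κ k` (the LZ half's residue at ONE level, = the `∀ k`-body of ✓`PortRecordLZHalf`) and `FEResidueBoxAt F Mc a₀ ε₂₉ γ₀ α₀ α₁ E₂ κ k` (the FE half's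
  residue at ONE level on the box, = the `∀ k`-body of ✓`PortRecordFEHalfBox`) — names for the two per-level formats, nothing else.
* §2 ★★ `FEStepBox F` — THE INDUCTIVE STEP ON THE BOX: under the ⁸ antecedent VERBATIM (✓`PortRecordFEHalfBox` :139 up to its last `→`), FE picks the (2.9) radius `ε₂₉ > 0` FIRST (print's
  absolute `ε₁`, p.266), then for EVERY package of LZ constants `(E₁ ≥ 0, κ₁ ≥ 4κ₀(64,8), β₀ β₁ > 0)` carrying the LZ residue at every level (what ✓`PortRecordLZHalf` delivers at that `ε₂₉`)
  FE answers with `γ₀ E₂ κ α₀ α₁` (print: `γ ≤ γ₀(E₀)`, `E₀`, `κ`, the radii of (1.11)–(1.16) — k-UNIFORM) such that for every `k`: the FE residues at ALL `j < k` on the box `]0,γ₀]^{j+1}`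
  (the inductive hypothesis — together with the LZ residues they give (1.7)+(1.18)+(1.19) for `𝓝_{j+1}`, `j < k`, by ✓`residueAtW_add`) IMPLY the FE residue at `k` on `]0,γ₀]^{k+1}` with the
  SAME constants.  OPEN (XXL: [I] §2 chart law (2.10)–(2.14) + §3–§5 + [II] Lemmas 1–3 at the record) — the genuine content of `stub_FE`, re-shaped, not reduced.
* §3 ★★★ `portRecordFEHalfBox_of_lzHalf_step : (∀ F, PortRecordLZHalf F) → (∀ F, FEStepBox F) → ∀ F, PortRecordFEHalfBox F` — `Nat.strong_induction_on`; the LZ half feeds the step its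
  constants at FE's `ε₂₉`; nothing else.  `lzHalf_of_lzjac_GL` ∕ ★★★ `portRecordFEHalfBox_of_lzjac_GL_step : (∀ F, PortRecordLZjacHalf F) → (∀ F, P0HolExtAtRecordGL F) → (∀ F, G3CAtRecordL F) →
  (∀ F, FEStepBox F) → ∀ F, PortRecordFEHalfBox F` — the Gaussian sub-half from the LANDED integer twin ✓`stub_LZdetTwin` and ✓`lzdetHalf_of_twin_GL`, glued by ✓`lzHalf_of_jac_det`; conclusion =
  THE REGISTERED STUB's TYPE LITERALLY.  The δ-Jacobian sub-half `∀ F, PortRecordLZjacHalf F` is a THEOREM of the tree (✓`lzjacHalf_of_jacRowsAB_all (jacRowsAB_all_of_kstep_of_dom stub_LZjacKStep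
  stub_LZjacDom)`, module `…PortS1JacGlue`, which sits in the route file's import cone — so the fully discharged `stub_FE_of_step : P0HolExtAtRecordGL → G3CAtRecordL → FEStepBox → stub_FE` and the
  crux-by-name composition live in the cone-side leaf `…PortS1FEInductionByName`, keeping THIS file route-independent, docket O-8); ★★ `sig8LR4Box_of_lzjac_GL_step` (box edition of ⁸ via ✓`sig8LR4Box_of_halves`).
DEDUP: `LZResidueAt`, `FEResidueBoxAt`, `FEStepBox`, `feResidueBoxAt_all_of_step`, `portRecordFEHalfBox_of_lzHalf_step`, `lzHalf_of_lzjac_GL`, `portRecordFEHalfBox_of_lzjac_GL_step`,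
`sig8LR4Box_of_lzjac_GL_step` — 0 tree hits (`rg -ow` 2026-08-31); everything else is IMPORTED and used by name.  (Q-ord): `Mth` outermost and the antecedent exactly as ⁸∕the box text; inside, `ε₂₉` before the LZ constants (✓`PortRecordLZHalf`
is `∀ ε₂₉ > 0`), FE's `γ₀ E₂ κ α₀ α₁` after them and before `k` — k-uniform, as Thm 3 demands.

HONEST STATUS.  Two per-level format NAMES, ONE letter (the inductive step — OPEN, inhabited nowhere, Bałaban-strength) and kernel bookkeeping (strong induction + the landed LZ assembly);
NOTHING of Bałaban's renormalization-group analysis ((2.10)–(2.14), §3–§5, [II]) is asserted, ported, discharged or refuted here; `stub_FE` is NOT closed (it is re-expressed: closed BY NAME the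
moment `FEStepBox` is inhabited, given `stub_P0C` and `stub_G3C`); `stub_P0C` OPEN; ⟨27930⟩ OPEN (1∕3); NODE O 0∕1; COUNT 8∕28 · K 1∕4 UNMOVED; finite 𝕋⁴_{L^K} at fixed ε — NOT
continuum ∕ OS ∕ Clay; **the Yang–Mills mass gap (Clay) is NOT proved by any of this.**  No `sorry`, `instance`, `notation`; standard axioms.

References: T. Bałaban, *Renormalization group approach to lattice gauge field theories. I*, Comm. Math. Phys. 109 (1987) 249–301 [Balaban1987RG1] — Thm 3 p.264, (1.7) p.261,
(1.18)–(1.19) p.263, (0.23) p.256, (2.12)–(2.14) p.268, p.268 L27–31, p.269 L30–33; T. Bałaban, *… II. Cluster expansions*, Comm. Math. Phys. 116 (1988) 1–22 [Balaban1988RG2Cluster] — Lemma 3 p.21.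
-/

noncomputable section

open scoped BigOperators Matrix.Norms.L2Operator Topology

namespace Summit.QuantumFields.YangMills.Theorems.BalabanUVNodesPortS1

open Summit.QuantumFields.YangMills.Theorems.K0RecordFormatNames
open Literature.MathematicalPhysics.QuantumFieldTheory.Balaban1983to89
open Literature.MathematicalPhysics.QuantumFieldTheory.Balaban1983to89.Node00
open Literature.MathematicalPhysics.QuantumFieldTheory.Balaban1983to89.T4Continuum (T4Family)
open _root_.Filter

/-! ## §1  The two per-level formats, named -/

/-- **The LZ half's wrap-aware residue AT ONE LEVEL `k`** (the `∀ k`-body of ✓`PortRecordLZHalf`, verbatim): one integer-local formula `Ψ` + free wrap pieces `Ew` with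
`Ψ.ResidueAtW … α₀ α₁ E₁ κ (phiLZ F Mc a₀ ε₂₉ k)`.  A NAME for a format; asserts nothing. [cite: Balaban1987RG1, (1.4) p.260, (1.18) p.263, (2.12) p.268] -/
def LZResidueAt (F : T4Family) (Mc : ℕ) (a₀ ε₂₉ α₀ α₁ E₁ κ : ℝ) (k : ℕ) : Prop :=
  ∃ (Ψ : IntLocalFormula (F.L ^ (k + 1) * Mc)) (Ew : TorusPieces F Mc k), Ψ.ResidueAtW F Mc k Ew a₀ ε₂₉ α₀ α₁ E₁ κ (phiLZ F Mc a₀ ε₂₉ k)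

/-- **The FE half's wrap-aware residue AT ONE LEVEL `k` ON THE BOX `]0,γ₀]^{k+1}`** (the `∀ k`-body of ✓`PortRecordFEHalfBox`, verbatim): at every box history `v`, one `Ψ` + wrap pieces
`Ew` with `Ψ.ResidueAtW … α₀ α₁ E₂ κ (phiFE F Mc a₀ ε₂₉ k v)`.  A NAME for a format; asserts nothing. [cite: Balaban1987RG1, (2.12)–(2.13) p.268, (1.18) p.263, Thm 3 p.264] -/
def FEResidueBoxAt (F : T4Family) (Mc : ℕ) (a₀ ε₂₉ γ₀ α₀ α₁ E₂ κ : ℝ) (k : ℕ) : Prop :=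
  ∀ v : Fin (k + 1) → ℝ, v ∈ FlowStep.Box γ₀ k →
    ∃ (Ψ : IntLocalFormula (F.L ^ (k + 1) * Mc)) (Ew : TorusPieces F Mc k), Ψ.ResidueAtW F Mc k Ew a₀ ε₂₉ α₀ α₁ E₂ κ (phiFE F Mc a₀ ε₂₉ k v)

/-! ## §2  ★★ The inductive-step letter -/

/-- ★★ **`FEStepBox F` — THE FLUCTUATION-EXPANSION HALF AS PRINT's INDUCTIVE STEP, ON THE BOX.**  Under the ⁸ antecedent (✓`PortRecordFEHalfBox` VERBATIM up to its last `→`): FE picks the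
(2.9) radius `ε₂₉ > 0`; then for every LZ package `(E₁, κ₁, β₀, β₁)` with the LZ residue at every level (`LZResidueAt`, = what ✓`PortRecordLZHalf` gives at this `ε₂₉`) there are k-UNIFORM
`γ₀ E₂ κ α₀ α₁` such that, for every `k`, the FE residues on the box at all `j < k` (the inductive hypothesis (1.7)+(1.18)+(1.19) for `𝓝_{j+1}`, `j < k`, FE part; the LZ part is the hypothesis
above) imply the FE residue on the box at `k` — [I] Thm 3 at scale `k+1` from scales `≤ k`: the chart law (2.10)–(2.14) + the localisation of (2.13) (§3–§5, [II] Lemmas 1–3) AT THE RECORD.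
OPEN (XXL) — the content of `stub_FE`, re-shaped as print proves it; inhabited nowhere; a CANDIDATE letter for the plan owner, not a signed item.
LOCATED CAVEAT (currency, said not hidden): the tree's (f′)-W row `IntFormula.RepresentsW` identifies the functional with the sum of its pieces EVENTUALLY AT `B = 0` (a germ — what
the β-layer consumers of ⟨27930⟩ read), whereas print's inductive assumption (1.7) is an identity on the whole small-field domain (1.1)–(1.2) p.260, and the step at scale `k+1` evaluates
`𝐄_k` at `U_k(exp(iB′)V^{(k)})` for `B′` ranging over the (2.9) window — a region of fixed radius, not a germ.  This letter is stated in the tree's currency (hypothesis AND conclusion per-level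
`ResidueAtW`); if the step's prover needs the lower-level identification on a displayed ball `‖B‖ < r` (k-uniform `r`), BOTH sides of the step are to be re-cut to that ball edition — the strong
induction of §3 closes verbatim in either currency and the ball edition implies the germ edition consumed by `PortRecordFEHalfBox`.
[cite: Balaban1987RG1, Thm 3 p.264, p.268 L27–31, p.269 L30–33, (2.12)–(2.14) p.268, (0.23) p.256, (1.7) p.261, (1.1)–(1.2) p.260, (1.18) p.263; Balaban1988RG2Cluster, Lemma 3 p.21] -/
def FEStepBox (F : T4Family) : Prop :=
  ∃ Mth : ℕ, ∀ Mc : ℕ, Mth ≤ Mc → ∀ (j c c₀ c₁ : ℕ) (B₃ B₃' a₀ a₁ : ℝ), Summit.QuantumFields.YangMills.Theorems.K0RecordFormatNames.McGuard F Mc → c ≤ F.L ^ j → c₀ ≤ j + 1 → c₁ ≤ j → 2 * (F.L : ℝ) ^ 2 ≤ B₃ → 0 < B₃' → 0 < a₀ → 0 < a₁ → Literature.MathematicalPhysics.QuantumFieldTheory.Balaban1983to89.Node00.VariationalThm1RegSepCoP7MGB F 2 (fun ν M g K k _s => c ≤ ν.M₁ ∧ k + c₀ ≤ F.m + K ∧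 F.L ^ c₁ ∣ M ∧ ∀ i, 1 ≤ i → i ≤ k → Literature.MathematicalPhysics.QuantumFieldTheory.Balaban1983to89.Node00.dCubeSide (F.P K).L M (Literature.MathematicalPhysics.QuantumFieldTheory.Balaban1983to89.Node00.RkOfRecord (F.P K).L ν.r (g i)) i ∣ (F.P K).sitesPerDir 0) (Literature.MathematicalPhysics.QuantumFieldTheory.Balaban1983to89.Node00.lamDatum F) (Literature.MathematicalPhysics.QuantumFieldTheory.Balaban1983to89.Node00.dataSmall7LamTopOf F 2) B₃ a₀ a₁ → Literature.MathematicalPhysics.QuantumFieldTheory.Balaban1983to89.Node00.Gauge9RegSepTopStepGB F 2 (fun ν K Ω => Literature.MathematicalPhysics.QuantumFieldTheory.Balaban1983to89.Node00.suppDomOfRecord F ν K Ω) (F.L ^ j) (fun ν M g K k _s => c ≤ ν.M₁ ∧ k + c₀ ≤ F.m + K ∧ F.L ^ c₁ ∣ M ∧ ∀ i, 1 ≤ i → i ≤ k → Literature.MathematicalPhysics.QuantumFieldTheory.Balaban1983to89.Node00.dCubeSide (F.P K).L M (Literature.MathematicalPhysics.QuantumFieldTheory.Balaban1983to89.Node00.RkOfRecord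 (F.P K).L ν.r (g i)) i ∣ (F.P K).sitesPerDir 0) (Literature.MathematicalPhysics.QuantumFieldTheory.Balaban1983to89.Node00.lamDatum F) (Literature.MathematicalPhysics.QuantumFieldTheory.Balaban1983to89.Node00.dataSmall7LamTopOf F 2) B₃ B₃' a₀ a₁ → (∀ ε₁ : ℝ, 0 < ε₁ → ε₁ ≤ a₁ → B₃ * ε₁ ≤ a₀ → ∀ (k n : ℕ) (V : Literature.MathematicalPhysics.QuantumFieldTheory.Balaban1983to89.GaugeField (F.P (Summit.QuantumFields.YangMills.Theorems.K0RecordFormatNames.recordK₀ F Mc k + n)) (k + 1) (Literature.MathematicalPhysics.QuantumFieldTheory.Balaban1983to89.Node00.SU 2)), Literature.MathematicalPhysics.QuantumFieldTheory.Balaban1983to89.PlaqSmall ε₁ V → Literature.MathematicalPhysics.QuantumFieldTheory.Balaban1983to89.Node00.UkExists F 2 (Summit.QuantumFields.YangMills.Theorems.K0RecordFormatNames.recordK₀ F Mc k + n) (k + 1) a₀ V ∧ Literature.MathematicalPhysics.QuantumFieldTheory.Balaban1983to89.Node00.UniqueUkOrbit F 2 (Summit.QuantumFields.YangMills.Theorems.K0RecordFormatNames.recordK₀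 F Mc k + n) (k + 1) a₀ V) → (∀ (k n : ℕ) (ε₂₉ : ℝ), 0 < ε₂₉ → letI θ := Summit.QuantumFields.YangMills.Theorems.K0RecordFormatNames.thetaFill F a₀ ε₂₉; letI := θ.instVβ₁; letI := θ.instVβ₂; letI := θ.instιβ; AnalyticAt ℝ (fun B : Summit.QuantumFields.YangMills.Theorems.K0RecordFormatNames.recordW F a₀ ε₂₉ k (Summit.QuantumFields.YangMills.Theorems.K0RecordFormatNames.recordK₀ F Mc k + n) => fun (b : Literature.MathematicalPhysics.QuantumFieldTheory.Balaban1983to89.PBond (F.P (Summit.QuantumFields.YangMills.Theorems.K0RecordFormatNames.recordK₀ F Mc k + n)) 0) (i i' : Fin 2) => ((Summit.QuantumFields.YangMills.Theorems.K0RecordFormatNames.recordBgField F θ k (Summit.QuantumFields.YangMills.Theorems.K0RecordFormatNames.recordK₀ F Mc k + n) B b : Literature.MathematicalPhysics.QuantumFieldTheory.Balaban1983to89.Node00.SU 2) : Matrix (Fin 2) (Fin 2) ℂ) i i') 0) → (∃ C₉' δ₉ : ℝ, 0 ≤ C₉' ∧ 0 < δ₉ ∧ ∀ (k n : ℕ)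 (ε₂₉ : ℝ), 0 < ε₂₉ → letI θ := Summit.QuantumFields.YangMills.Theorems.K0RecordFormatNames.thetaFill F a₀ ε₂₉; letI := θ.instVβ₁; letI := θ.instVβ₂; letI := θ.instιβ; ∀ (a : θ.ιβ) (μ : Fin (F.P (Summit.QuantumFields.YangMills.Theorems.K0RecordFormatNames.recordK₀ F Mc k + n)).d) (y : Literature.MathematicalPhysics.QuantumFieldTheory.Balaban1983to89.Site (F.P (Summit.QuantumFields.YangMills.Theorems.K0RecordFormatNames.recordK₀ F Mc k + n)) (k + 1)), letI D := fderiv ℝ (fun B : Summit.QuantumFields.YangMills.Theorems.K0RecordFormatNames.recordW F a₀ ε₂₉ k (Summit.QuantumFields.YangMills.Theorems.K0RecordFormatNames.recordK₀ F Mc k + n) => fun (b : Literature.MathematicalPhysics.QuantumFieldTheory.Balaban1983to89.PBond (F.P (Summit.QuantumFields.YangMills.Theorems.K0RecordFormatNames.recordK₀ F Mc k + n)) 0) (i i' : Fin 2) => ((Summit.QuantumFields.YangMills.Theorems.K0RecordFormatNames.recordBgField F θ k (Summit.QuantumFields.YangMills.Theorems.K0RecordFormatNames.recordK₀ F Mc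 k + n) B b : Literature.MathematicalPhysics.QuantumFieldTheory.Balaban1983to89.Node00.SU 2) : Matrix (Fin 2) (Fin 2) ℂ) i i') 0 (Pi.single μ (Pi.single y (θ.bV a))); ∃ (Hr : Literature.MathematicalPhysics.QuantumFieldTheory.Balaban1983to89.PBond (F.P (Summit.QuantumFields.YangMills.Theorems.K0RecordFormatNames.recordK₀ F Mc k + n)) 0 → Fin 2 → Fin 2 → ℂ) (φ : Literature.MathematicalPhysics.QuantumFieldTheory.Balaban1983to89.Site (F.P (Summit.QuantumFields.YangMills.Theorems.K0RecordFormatNames.recordK₀ F Mc k + n)) 0 → Fin 2 → Fin 2 → ℂ), (∀ b : Literature.MathematicalPhysics.QuantumFieldTheory.Balaban1983to89.PBond (F.P (Summit.QuantumFields.YangMills.Theorems.K0RecordFormatNames.recordK₀ F Mc k + n)) 0, D b = Hr b + (φ b.src - φ (b.src.shift b.dir))) ∧ (∃ μc : Literature.MathematicalPhysics.QuantumFieldTheory.Balaban1983to89.Site (F.P (Summit.QuantumFields.YangMills.Theorems.K0RecordFormatNames.recordK₀ F Mc k + n)) (k + 1) → Fin 2 → Fin 2 → ℂ, ∀ x :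 Literature.MathematicalPhysics.QuantumFieldTheory.Balaban1983to89.Site (F.P (Summit.QuantumFields.YangMills.Theorems.K0RecordFormatNames.recordK₀ F Mc k + n)) 0, letI dv := (fun x' : Literature.MathematicalPhysics.QuantumFieldTheory.Balaban1983to89.Site (F.P (Summit.QuantumFields.YangMills.Theorems.K0RecordFormatNames.recordK₀ F Mc k + n)) 0 => ∑ ν : Fin (F.P (Summit.QuantumFields.YangMills.Theorems.K0RecordFormatNames.recordK₀ F Mc k + n)).d, (Hr ⟨x', ν⟩ - Hr ⟨x'.unshift ν, ν⟩)); ∑ ν : Fin (F.P (Summit.QuantumFields.YangMills.Theorems.K0RecordFormatNames.recordK₀ F Mc k + n)).d, (dv (x.shift ν) - (2 : ℂ) • dv x + dv (x.unshift ν)) = μc (Summit.QuantumFields.YangMills.Theorems.K0RecordFormatNames.coarsenTo (k + 1) x)) ∧ ∀ b : Literature.MathematicalPhysics.QuantumFieldTheory.Balaban1983to89.PBond (F.P (Summit.QuantumFields.YangMills.Theorems.K0RecordFormatNames.recordK₀ F Mc k + n)) 0, ‖Hr b‖ ≤ C₉' * (F.P (Summit.QuantumFields.YangMills.Theorems.K0RecordFormatNames.recordK₀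 F Mc k + n)).eta (k + 1) * Real.exp (-(δ₉ * (Literature.MathematicalPhysics.QuantumFieldTheory.Balaban1983to89.Site.tdist (Summit.QuantumFields.YangMills.Theorems.K0RecordFormatNames.coarsenTo (k + 1) b.src) y : ℝ))) ∧ (∀ ν : Fin (F.P (Summit.QuantumFields.YangMills.Theorems.K0RecordFormatNames.recordK₀ F Mc k + n)).d, ‖Hr (⟨b.src.shift ν, b.dir⟩ : Literature.MathematicalPhysics.QuantumFieldTheory.Balaban1983to89.PBond (F.P (Summit.QuantumFields.YangMills.Theorems.K0RecordFormatNames.recordK₀ F Mc k + n)) 0) - Hr b‖ ≤ C₉' * (F.P (Summit.QuantumFields.YangMills.Theorems.K0RecordFormatNames.recordK₀ F Mc k + n)).eta (k + 1) ^ 2 * Real.exp (-(δ₉ * (Literature.MathematicalPhysics.QuantumFieldTheory.Balaban1983to89.Site.tdist (Summit.QuantumFields.YangMills.Theorems.K0RecordFormatNames.coarsenTo (k + 1) b.src) y : ℝ)))) ∧ ‖∑ ν : Fin (F.P (Summit.QuantumFields.YangMills.Theorems.K0RecordFormatNames.recordK₀ F Mc k + n)).d, (Hr (⟨b.src.shift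 ν, b.dir⟩ : Literature.MathematicalPhysics.QuantumFieldTheory.Balaban1983to89.PBond (F.P (Summit.QuantumFields.YangMills.Theorems.K0RecordFormatNames.recordK₀ F Mc k + n)) 0) - (2 : ℂ) • Hr b + Hr (⟨b.src.unshift ν, b.dir⟩ : Literature.MathematicalPhysics.QuantumFieldTheory.Balaban1983to89.PBond (F.P (Summit.QuantumFields.YangMills.Theorems.K0RecordFormatNames.recordK₀ F Mc k + n)) 0))‖ ≤ C₉' * (F.P (Summit.QuantumFields.YangMills.Theorems.K0RecordFormatNames.recordK₀ F Mc k + n)).eta (k + 1) ^ 3 * Real.exp (-(δ₉ * (Literature.MathematicalPhysics.QuantumFieldTheory.Balaban1983to89.Site.tdist (Summit.QuantumFields.YangMills.Theorems.K0RecordFormatNames.coarsenTo (k + 1) b.src) y : ℝ))) ∧ ‖∑ ν : Fin (F.P (Summit.QuantumFields.YangMills.Theorems.K0RecordFormatNames.recordK₀ F Mc k + n)).d, ((Hr (⟨b.src, b.dir⟩ : Literature.MathematicalPhysics.QuantumFieldTheory.Balaban1983to89.PBond (F.P (Summit.QuantumFields.YangMills.Theorems.K0RecordFormatNames.recordK₀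 F Mc k + n)) 0) + Hr (⟨(b.src).shift b.dir, ν⟩ : Literature.MathematicalPhysics.QuantumFieldTheory.Balaban1983to89.PBond (F.P (Summit.QuantumFields.YangMills.Theorems.K0RecordFormatNames.recordK₀ F Mc k + n)) 0) - Hr (⟨(b.src).shift ν, b.dir⟩ : Literature.MathematicalPhysics.QuantumFieldTheory.Balaban1983to89.PBond (F.P (Summit.QuantumFields.YangMills.Theorems.K0RecordFormatNames.recordK₀ F Mc k + n)) 0) - Hr (⟨b.src, ν⟩ : Literature.MathematicalPhysics.QuantumFieldTheory.Balaban1983to89.PBond (F.P (Summit.QuantumFields.YangMills.Theorems.K0RecordFormatNames.recordK₀ F Mc k + n)) 0)) - (Hr (⟨b.src.unshift ν, b.dir⟩ : Literature.MathematicalPhysics.QuantumFieldTheory.Balaban1983to89.PBond (F.P (Summit.QuantumFields.YangMills.Theorems.K0RecordFormatNames.recordK₀ F Mc k + n)) 0) + Hr (⟨(b.src.unshift ν).shift b.dir, ν⟩ : Literature.MathematicalPhysics.QuantumFieldTheory.Balaban1983to89.PBond (F.P (Summit.QuantumFields.YangMills.Theorems.K0RecordFormatNames.recordK₀ F Mc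 k + n)) 0) - Hr (⟨(b.src.unshift ν).shift ν, b.dir⟩ : Literature.MathematicalPhysics.QuantumFieldTheory.Balaban1983to89.PBond (F.P (Summit.QuantumFields.YangMills.Theorems.K0RecordFormatNames.recordK₀ F Mc k + n)) 0) - Hr (⟨b.src.unshift ν, ν⟩ : Literature.MathematicalPhysics.QuantumFieldTheory.Balaban1983to89.PBond (F.P (Summit.QuantumFields.YangMills.Theorems.K0RecordFormatNames.recordK₀ F Mc k + n)) 0)))‖ ≤ C₉' * (F.P (Summit.QuantumFields.YangMills.Theorems.K0RecordFormatNames.recordK₀ F Mc k + n)).eta (k + 1) ^ 3 * Real.exp (-(δ₉ * (Literature.MathematicalPhysics.QuantumFieldTheory.Balaban1983to89.Site.tdist (Summit.QuantumFields.YangMills.Theorems.K0RecordFormatNames.coarsenTo (k + 1) b.src) y : ℝ)))) → ∃ ε₂₉ : ℝ, 0 < ε₂₉ ∧ ∀ (E₁ κ₁ β₀ β₁ : ℝ), 0 ≤ E₁ → 4 * Literature.MathematicalPhysics.QuantumFieldTheory.Balaban1983to89.B12TreeDecay.kappa₀ (4 * 2 ^ 4) (2 * 4) ≤ κ₁ →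 0 < β₀ → 0 < β₁ → (∀ k : ℕ, Summit.QuantumFields.YangMills.Theorems.BalabanUVNodesPortS1.LZResidueAt F Mc a₀ ε₂₉ β₀ β₁ E₁ κ₁ k) → ∃ γ₀ E₂ κ α₀ α₁ : ℝ, 0 < γ₀ ∧ 0 ≤ E₂ ∧ 4 * Literature.MathematicalPhysics.QuantumFieldTheory.Balaban1983to89.B12TreeDecay.kappa₀ (4 * 2 ^ 4) (2 * 4) ≤ κ ∧ 0 < α₀ ∧ 0 < α₁ ∧ ∀ k : ℕ, (∀ j : ℕ, j < k → Summit.QuantumFields.YangMills.Theorems.BalabanUVNodesPortS1.FEResidueBoxAt F Mc a₀ ε₂₉ γ₀ α₀ α₁ E₂ κ j) → Summit.QuantumFields.YangMills.Theorems.BalabanUVNodesPortS1.FEResidueBoxAt F Mc a₀ ε₂₉ γ₀ α₀ α₁ E₂ κ k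

/-! ## §3  ★★★ The FE half from the LZ half and the step (strong induction on the scale); `stub_FE` BY NAME from three letters -/

/-- **All FE residues from the LZ family and the step** — the strong induction on `k` ([I] p.268 L27–31: Thm 3 at scale `k+1` from the inductive assumption at scales `≤ k`), at fixed constants.
[cite: Balaban1987RG1, p.268 L27–31, Thm 3 p.264] -/
theorem feResidueBoxAt_all_of_step {F : T4Family} {Mc : ℕ} {a₀ ε₂₉ γ₀ α₀ α₁ E₂ κ : ℝ}
    (hstep : ∀ k : ℕ, (∀ j : ℕ, j < k → FEResidueBoxAt F Mc a₀ ε₂₉ γ₀ α₀ α₁ E₂ κ j) → FEResidueBoxAt F Mc a₀ ε₂₉ γ₀ α₀ α₁ E₂ κ k) :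
    ∀ k : ℕ, FEResidueBoxAt F Mc a₀ ε₂₉ γ₀ α₀ α₁ E₂ κ k :=
  fun k => Nat.strong_induction_on k fun n ih => hstep n ih

/-- ★★★ **`PortRecordFEHalfBox` FROM THE LZ HALF AND THE INDUCTIVE STEP** (every `F`): `Mth := max`; under the antecedent take FE's `ε₂₉` (step), the LZ constants `(E₁, κ₁, β₀, β₁)` and the LZ
residues at every level (✓`PortRecordLZHalf` at that `ε₂₉`), feed them to the step, and run the strong induction `feResidueBoxAt_all_of_step`.  CONDITIONAL bookkeeping; both hypotheses OPEN.
[cite: Balaban1987RG1, Thm 3 p.264, p.268 L27–31, (2.12)–(2.14) p.268] -/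
theorem portRecordFEHalfBox_of_lzHalf_step (hLZ : ∀ F, PortRecordLZHalf F) (hS : ∀ F, FEStepBox F) : ∀ F, PortRecordFEHalfBox F := by
  intro F
  obtain ⟨M₁, H₁⟩ := hLZ F
  obtain ⟨M₂, H₂⟩ := hS F
  refine ⟨max M₁ M₂, fun Mc hMc j c c₀ c₁ B₃ B₃' a₀ a₁ hG h₁ h₂ h₃ h₄ h₅ h₆ h₇ hT8 hT9 hTE hP9 hP9L => ?_⟩
  obtain ⟨ε₂₉, hε, HS⟩ := H₂ Mc (le_of_max_le_right hMc) j c c₀ c₁ B₃ B₃' a₀ a₁ hG h₁ h₂ h₃ h₄ h₅ h₆ h₇ hT8 hT9 hTE hP9 hP9L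
  obtain ⟨E₁, κ₁, β₀, β₁, hE₁, hκ₁, hβ₀, hβ₁, HLZ⟩ :=
    H₁ Mc (le_of_max_le_left hMc) j c c₀ c₁ B₃ B₃' a₀ a₁ hG h₁ h₂ h₃ h₄ h₅ h₆ h₇ hT8 hT9 hTE hP9 hP9L ε₂₉ hε
  obtain ⟨γ₀, E₂, κ, α₀, α₁, hγ, hE₂, hκ, hα₀, hα₁, Hstep⟩ := HS E₁ κ₁ β₀ β₁ hE₁ hκ₁ hβ₀ hβ₁ (fun k => HLZ k)
  exact ⟨γ₀, ε₂₉, E₂, κ, α₀, α₁, hγ, hε, hE₂, hκ, hα₀, hα₁, fun k v hv => feResidueBoxAt_all_of_step Hstep k v hv⟩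

/-- **The LZ half from the δ-Jacobian sub-half and the two open LZ letters** (`stub_P0C`'s `P0HolExtAtRecordGL`, `stub_G3C`'s `G3CAtRecordL`): the Gaussian sub-half from the LANDED integer twin
✓`stub_LZdetTwin` and ✓`lzdetHalf_of_twin_GL`, glued to the δ-Jacobian sub-half by ✓`lzHalf_of_jac_det`.  (The δ-Jacobian sub-half is itself a theorem of the tree — ✓`lzjacHalf_of_jacRowsAB_all
(jacRowsAB_all_of_kstep_of_dom stub_LZjacKStep stub_LZjacDom)` — discharged in the cone-side leaf `…PortS1FEInductionByName`.)  CONDITIONAL bookkeeping.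
[cite: Balaban1987RG1, (1.4) p.260, (2.12) p.268; Balaban1985UV3, (63) p.272] -/
theorem lzHalf_of_lzjac_GL (hJ : ∀ F, PortRecordLZjacHalf F) (hP0C : ∀ F, P0HolExtAtRecordGL F) (hG3C : ∀ F, G3CAtRecordL F) : ∀ F, PortRecordLZHalf F :=
  lzHalf_of_jac_det hJ (fun F => lzdetHalf_of_twin_GL F (stub_LZdetTwin F) (hP0C F) (hG3C F))

/-- ★★★ **`PortRecordFEHalfBox` — THE REGISTERED STUB's TYPE LITERALLY — from the δ-Jacobian sub-half, the P0-ℂ letter, the G3C letter and the inductive step.**  CONDITIONAL; the three letters OPEN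
(the δ-Jacobian sub-half is a theorem of the tree, see `…PortS1FEInductionByName.stub_FE_of_step`); nothing asserted. [cite: Balaban1987RG1, Thm 3 p.264, (2.12)–(2.14) p.268, p.268 L27–31] -/
theorem portRecordFEHalfBox_of_lzjac_GL_step (hJ : ∀ F, PortRecordLZjacHalf F) (hP0C : ∀ F, P0HolExtAtRecordGL F) (hG3C : ∀ F, G3CAtRecordL F) (hS : ∀ F, FEStepBox F) :
    ∀ F, Summit.QuantumFields.YangMills.Theorems.BalabanUVNodesPortS1.PortRecordFEHalfBox F :=
  portRecordFEHalfBox_of_lzHalf_step (lzHalf_of_lzjac_GL hJ hP0C hG3C) hS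

/-- ★★ **The box edition of ⁸ from the same letters** (✓`sig8LR4Box_of_halves`; hence the signed text by ✓`sig8LR4_of_box`). CONDITIONAL bookkeeping.
[cite: Balaban1987RG1, Thm 3 p.264, (1.18)–(1.22) pp.263–264] -/
theorem sig8LR4Box_of_lzjac_GL_step (hJ : ∀ F, PortRecordLZjacHalf F) (hP0C : ∀ F, P0HolExtAtRecordGL F) (hG3C : ∀ F, G3CAtRecordL F) (hS : ∀ F, FEStepBox F) :
    ∀ F, Sig8LR4Box F :=
  sig8LR4Box_of_halves (lzHalf_of_lzjac_GL hJ hP0C hG3C) (portRecordFEHalfBox_of_lzjac_GL_step hJ hP0C hG3C hS)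

-- standard axioms only
#print axioms portRecordFEHalfBox_of_lzHalf_step
#print axioms portRecordFEHalfBox_of_lzjac_GL_step
#print axioms sig8LR4Box_of_lzjac_GL_step

end Summit.QuantumFields.YangMills.Theorems.BalabanUVNodesPortS1

end
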